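import Summits.QuantumFields.YangMills.Theorems.SwapVirialDeficitSectorLaplaceTipCornerLayer
import Summits.QuantumFields.YangMills.Theorems.SwapVirialDeficitSectorLaplaceMbDensityComparableProfile
import Summits.QuantumFields.YangMills.Theorems.SwapVirialDeficitSectorLaplaceTipShellDischarge
import Summits.QuantumFields.YangMills.Theorems.SwapVirialDeficitSectorLaplaceEndGaussShellInterface
import HarnessLib

/-!
# THE TIP OF SKELETON ➎, THE CORNER DISC AGAINST THE BULK MAIN TERM — concrete composition
# (cell ym-idea-1; free-hands support of ⟨stmt-QuantumFields-24197⟩ `SwapVirialDeficit.SwapGluedStiffness`; LEAD g99 ruling (R1) 2026-09-01 01:07Z; g49's layer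
# ✓`tipCorner_le_shell_of_pointwise` ∘ w2 g61's two-point profile law ✓`mbDensity_hubAt_comparable_profile` ∘ w3 g68's ✓`shell_boxMass_le_mbMain`)

With the matching letter `δr(L) = 12·122689728·2304·|Fol L|²·L¹⁰` and the matching radius `ρO(L) = (12·|Fol L|·44712000·L⁴·2304·L⁶·|Fol L|)⁻¹` (the two halves of the
joint window of ✓`mbDensity_hubAt_comparable_profile`), shell `[δr, 2δr]`, reference square `A′ = [ρ₀, ρO/2] × [0, ρO/2] ⊆ Box = {ρ₀² ≤ |p|²}`:
* `cornerWindow_facts` — sizes of `δr`, `ρO`; the window halves;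
* ★★ `tipCorner_le_mbMain` — for good `ε`, `0 < τ ≤ (1 + 16·δr²)⁻¹`, `0 < ρ₀ ≤ min 1 (ρO/4)`, any measurable `Mid ⊆ Ioi √(τ⁻¹−1)`:
  `coneConst·π·∫_{Mid}((1+δ²)⁻¹)²·∫_{|p|²<ρ₀²}𝔪(hubAt δ 1) ≤ Ccor(L, ρ₀)·(√(τ⁻¹−1))^{−3/4}·M_ε` with `Ccor` an explicit polynomial-type expression
  (`κ = ½`, `R = 2δr·R₀`, `Osc = R₀(1+4δr²)²(1+ρO²)²`, `V = ρO²/8`).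

HONEST LABEL: composition bookkeeping; `stub_core_tip` (core ceiling, glue), ⟨24197⟩ ∕ ⟨24194⟩ OPEN; item of record ⟨24085⟩ `SubOctaveBounded` aside ∕ untouched; the
Yang–Mills mass gap is NOT proved; no summit is proved by a line.  THEOREMS ONLY (0 `def`, 0 `sorry`), standard axioms, no instances.  Seat ym-line-fcl-p3 g49 (cell
ym-idea-1, free hands = ➎ assembler), `--supports stmt-QuantumFields-24197`.  References: [cite: Luscher1983, §2]; [folklore].
-/

set_option autoImplicit false
set_option synthInstance.maxSize 1024

noncomputable section

open MeasureTheory Quaternion Set Module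
open scoped Quaternion BigOperators ENNReal
open Literature.MathematicalPhysics.QuantumLattice
open Literature.MathematicalPhysics.QuantumFieldTheory hiding SU2
open Summit.QuantumFields.YangMills.Theorems.SwapTwistDeficit.ToronLog

namespace Summit.QuantumFields.YangMills.Theorems.SwapVirialDeficit.SectorLaplace

open Summit.QuantumFields.YangMills.Theorems.FemtoTransferGap
open Summit.QuantumFields.YangMills.Theorems.FemtoTransferGap.TT
open Summit.QuantumFields.YangMills.Theorems.VirialFluxGap.RingDeficit
open Summit.QuantumFields.YangMills.Theorems.SwapVirialDeficit.SwapRing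
open Summit.QuantumFields.YangMills.Theorems.SwapVirialDeficit.BlowUpRing

variable {L : ℕ} [NeZero L]

/-! ## §1 The matching letter `δr(L)` and radius `ρO(L)` -/

/-- The matching letter `δr = 12·122689728·2304·|Fol|²·L¹⁰ ≥ 1` and radius `ρO = (12·|Fol|·44712000·L⁴·2304·L⁶·|Fol|)⁻¹ ∈ (0,1]` use up exactly the two halves of the joint
matching window of ✓`mbDensity_hubAt_comparable_profile`. [folklore] -/
theorem cornerWindow_facts :
    1 ≤ (12 * 122689728 * 2304 * (Fintype.card (Fol L) : ℝ) ^ 2 * (L : ℝ) ^ 10) ∧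
    0 < (12 * (Fintype.card (Fol L) : ℝ) * 44712000 * (L : ℝ) ^ 4 * (2304 * (L : ℝ) ^ 6 * (Fintype.card (Fol L) : ℝ)))⁻¹ ∧
    (12 * (Fintype.card (Fol L) : ℝ) * 44712000 * (L : ℝ) ^ 4 * (2304 * (L : ℝ) ^ 6 * (Fintype.card (Fol L) : ℝ)))⁻¹ ≤ 1 ∧
    122689728 * (12 * 122689728 * 2304 * (Fintype.card (Fol L) : ℝ) ^ 2 * (L : ℝ) ^ 10)⁻¹ * (L : ℝ) ^ 4 =
      (2304 * (L : ℝ) ^ 6 * (Fintype.card (Fol L) : ℝ))⁻¹ / (2 * (3 * (Fintype.card (Fol L) : ℝ))) / 2 ∧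
    ∀ D : ℝ, D ≤ (12 * (Fintype.card (Fol L) : ℝ) * 44712000 * (L : ℝ) ^ 4 * (2304 * (L : ℝ) ^ 6 * (Fintype.card (Fol L) : ℝ)))⁻¹ →
      44712000 * D * (L : ℝ) ^ 4 ≤ (2304 * (L : ℝ) ^ 6 * (Fintype.card (Fol L) : ℝ))⁻¹ / (2 * (3 * (Fintype.card (Fol L) : ℝ))) / 2 := by
  have hL1 : (1 : ℝ) ≤ L := by exact_mod_cast NeZero.one_le
  have hL0 : (0 : ℝ) < L := by linarith
  have hn1 : (1 : ℝ) ≤ (Fintype.card (Fol L) : ℝ) := by exact_mod_cast one_le_card_fol (L := L)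
  set n : ℝ := (Fintype.card (Fol L) : ℝ) with hn
  have hn0 : 0 < n := by linarith
  refine ⟨?_, by positivity, ?_, ?_, ?_⟩
  · have h1 : (1 : ℝ) ≤ n ^ 2 := one_le_pow₀ hn1
    have h2 : (1 : ℝ) ≤ (L : ℝ) ^ 10 := one_le_pow₀ hL1
    nlinarith
  · apply inv_le_one_of_one_le₀
    have h2 : (1 : ℝ) ≤ (L : ℝ) ^ 4 := one_le_pow₀ hL1
    have h3 : (1 : ℝ) ≤ (L : ℝ) ^ 6 := one_le_pow₀ hL1
    have h4 : (1 : ℝ) ≤ 2304 * (L : ℝ) ^ 6 * n := by nlinarith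
    nlinarith [mul_le_mul h2 h4 (by positivity) (by positivity)]
  · field_simp; ring
  · intro D hD
    have hpos : 0 < 12 * n * 44712000 * (L : ℝ) ^ 4 * (2304 * (L : ℝ) ^ 6 * n) := by positivity
    have e : (2304 * (L : ℝ) ^ 6 * n)⁻¹ / (2 * (3 * n)) / 2 = 44712000 * (12 * n * 44712000 * (L : ℝ) ^ 4 * (2304 * (L : ℝ) ^ 6 * n))⁻¹ * (L : ℝ) ^ 4 := by
      field_simp; ring
    rw [e]
    exact mul_le_mul_of_nonneg_right (mul_le_mul_of_nonneg_left hD (by norm_num)) (by positivity)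

/-! ## §2 ★★ The corner disc against the bulk main term -/

set_option maxHeartbeats 800000 in
/-- ★★ **THE CORNER DISC OF THE TIP WEIGHS A `τ^{3/8}`-RATE OF THE BULK MAIN TERM**: for good `ε`, `0 < τ ≤ (1 + 16·δr²)⁻¹` (so the shell `[δr, 2δr]` lies below the
tip window), a corner radius `0 < ρ₀ ≤ 1`, `ρ₀ ≤ ρO/4`, and any measurable `Mid ⊆ Ioi √(τ⁻¹ − 1)`:
`coneConst·π·∫_{Mid}((1+δ²)⁻¹)²·∫_{|p|²<ρ₀²}𝔪(hubAt δ 1) ≤ (256·(2δr·R₀)·Osc·(1+2√(½)ρ₀)^{1/4}/(½·(ρO²/8)))/W · (4/3)·(√(τ⁻¹−1))^{−3/4} · M_ε`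
(`R₀` = w2's constant, `Osc = R₀(1+(2δr)²)²(1+ρO²)²`, `W = ((1+δr²)⁻¹ − (1+(2δr)²)⁻¹)/2`). [cite: Luscher1983, §2] -/
theorem tipCorner_le_mbMain {ε : GnoSign L} (hε : GoodSign ε) {τ : ℝ} (hτ : 0 < τ)
    (hτw : τ ≤ (1 + 16 * (12 * 122689728 * 2304 * (Fintype.card (Fol L) : ℝ) ^ 2 * (L : ℝ) ^ 10) ^ 2)⁻¹)
    {ρ₀ : ℝ} (hρ₀ : 0 < ρ₀) (hρ₀1 : ρ₀ ≤ 1)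
    (hρ₀O : ρ₀ ≤ (12 * (Fintype.card (Fol L) : ℝ) * 44712000 * (L : ℝ) ^ 4 * (2304 * (L : ℝ) ^ 6 * (Fintype.card (Fol L) : ℝ)))⁻¹ / 4)
    {Mid : Set ℝ} (hMid : MeasurableSet Mid) (hMid₁ : Mid ⊆ Ioi (Real.sqrt (τ⁻¹ - 1))) :
    coneConst * Real.pi * ∫ δ in Mid, ((1 + δ ^ 2)⁻¹) ^ 2 * ∫ p in {p : ℝ × ℝ | p.1 ^ 2 + p.2 ^ 2 < ρ₀ ^ 2}, mbDensity (L := L) (hubAt δ 1) ε p ≤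
      (256 * (2 * (12 * 122689728 * 2304 * (Fintype.card (Fol L) : ℝ) ^ 2 * (L : ℝ) ^ 10) *
            (Real.exp 1 * ((1 + (finrank ℝ (GnoFol L) : ℝ)) * (20400 * (L : ℝ) ^ 4)) ^ (7 / 2 : ℝ) *
              (Real.sqrt ((1 / 4 : ℝ) * (1 / (1800 * (L : ℝ) ^ 6))) ^ 3)⁻¹ * (2 * (1800 * (L : ℝ) ^ 6) ^ 2))) *
          ((Real.exp 1 * ((1 + (finrank ℝ (GnoFol L) : ℝ)) * (20400 * (L : ℝ) ^ 4)) ^ (7 / 2 : ℝ) *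
              (Real.sqrt ((1 / 4 : ℝ) * (1 / (1800 * (L : ℝ) ^ 6))) ^ 3)⁻¹ * (2 * (1800 * (L : ℝ) ^ 6) ^ 2)) *
            (1 + (2 * (12 * 122689728 * 2304 * (Fintype.card (Fol L) : ℝ) ^ 2 * (L : ℝ) ^ 10)) ^ 2) ^ 2 *
            (1 + ((12 * (Fintype.card (Fol L) : ℝ) * 44712000 * (L : ℝ) ^ 4 * (2304 * (L : ℝ) ^ 6 * (Fintype.card (Fol L) : ℝ)))⁻¹) ^ 2) ^ 2) *
          (1 + 2 * Real.sqrt (1 / 2) * ρ₀) ^ (1 / 4 : ℝ) /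
          ((1 / 2 : ℝ) * (((12 * (Fintype.card (Fol L) : ℝ) * 44712000 * (L : ℝ) ^ 4 * (2304 * (L : ℝ) ^ 6 * (Fintype.card (Fol L) : ℝ)))⁻¹) ^ 2 / 8))) /
        (((1 + (12 * 122689728 * 2304 * (Fintype.card (Fol L) : ℝ) ^ 2 * (L : ℝ) ^ 10) ^ 2)⁻¹ -
            (1 + (2 * (12 * 122689728 * 2304 * (Fintype.card (Fol L) : ℝ) ^ 2 * (L : ℝ) ^ 10)) ^ 2)⁻¹) / 2) *
        ((4 / 3) * Real.sqrt (τ⁻¹ - 1) ^ (-(3 / 4 : ℝ))) *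
        ∫ a in HubBulk τ, (∫ p : ℝ × ℝ, mbDensity (L := L) a ε p) ∂coneMeasure := by
  obtain ⟨hδr1, hρO0, hρO1, hwin1, hwin2⟩ := cornerWindow_facts (L := L)
  set n : ℝ := (Fintype.card (Fol L) : ℝ) with hn
  set δr : ℝ := 12 * 122689728 * 2304 * n ^ 2 * (L : ℝ) ^ 10 with hδr
  set ρO : ℝ := (12 * n * 44712000 * (L : ℝ) ^ 4 * (2304 * (L : ℝ) ^ 6 * n))⁻¹ with hρO
  set R₀ : ℝ := Real.exp 1 * ((1 + (finrank ℝ (GnoFol L) : ℝ)) * (20400 * (L : ℝ) ^ 4)) ^ (7 / 2 : ℝ) *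
      (Real.sqrt ((1 / 4 : ℝ) * (1 / (1800 * (L : ℝ) ^ 6))) ^ 3)⁻¹ * (2 * (1800 * (L : ℝ) ^ 6) ^ 2) with hR₀
  set μ : ℝ := (2304 * (L : ℝ) ^ 6 * n)⁻¹ with hμ
  set δ₁ : ℝ := Real.sqrt (τ⁻¹ - 1) with hδ₁
  set D : Set (ℝ × ℝ) := {p : ℝ × ℝ | p.1 ^ 2 + p.2 ^ 2 < ρ₀ ^ 2} with hDdef
  set Box : Set (ℝ × ℝ) := {p : ℝ × ℝ | ρ₀ ^ 2 ≤ p.1 ^ 2 + p.2 ^ 2} with hBoxdef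
  set A' : Set (ℝ × ℝ) := Icc ρ₀ (ρO / 2) ×ˢ Icc 0 (ρO / 2) with hA'def
  have hL1 : (1 : ℝ) ≤ L := by exact_mod_cast NeZero.one_le
  have hcc : 0 < coneConst * Real.pi := mul_pos coneConst_pos Real.pi_pos
  have hR₀0 : 0 < R₀ := by
    rw [hR₀]
    have h1 : 0 < Real.sqrt ((1 / 4 : ℝ) * (1 / (1800 * (L : ℝ) ^ 6))) := Real.sqrt_pos.2 (by positivity)
    positivity
  have hδr0 : 0 < δr := by linarith
  -- the window: `τ ≤ 1/(1+16δr²) ≤ 1/2`, `c = 2δr ≤ δ₁`, shell inside the bulk window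
  have hτ1 : τ ≤ 1 := hτw.trans (inv_le_one_of_one_le₀ (le_add_of_nonneg_right (by positivity)))
  have hc2 : (2 * δr) ^ 2 ≤ τ⁻¹ - 1 := by
    have h1 : 1 + 16 * δr ^ 2 ≤ τ⁻¹ := by
      rw [le_inv_comm₀ (by positivity) hτ]; exact hτw
    have e : (2 * δr) ^ 2 = 4 * δr ^ 2 := by ring
    rw [e]; linarith [sq_nonneg δr]
  have hδ₁c : 2 * δr ≤ δ₁ := by
    rw [hδ₁, ← Real.sqrt_sq (by positivity : (0:ℝ) ≤ 2 * δr)]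
    exact Real.sqrt_le_sqrt hc2
  have hδ₁0 : 0 < δ₁ := lt_of_lt_of_le (by positivity) hδ₁c
  have hshell : Icc δr (2 * δr) ⊆ {δ : ℝ | τ ≤ 4 * δ ^ 2 / (1 + δ ^ 2) ^ 2 ∧ τ ≤ (1 + δ ^ 2)⁻¹} := Icc_subset_bulkWindow hτ hδr1 hc2
  -- the reference square `A'`
  have hA'm : MeasurableSet A' := measurableSet_Icc.prod measurableSet_Icc
  have hρO4 : ρ₀ ≤ ρO / 4 := hρ₀O
  have hA'B : A' ⊆ Box := by
    intro p hp
    rw [hA'def] at hp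
    obtain ⟨⟨h1, -⟩, -⟩ := hp
    show ρ₀ ^ 2 ≤ p.1 ^ 2 + p.2 ^ 2
    exact le_add_of_le_of_nonneg (pow_le_pow_left₀ hρ₀.le h1 2) (sq_nonneg _)
  have hA'vol : volume.real A' = (ρO / 2 - ρ₀) * (ρO / 2) := by
    rw [hA'def, Measure.volume_eq_prod, measureReal_prod_prod, Real.volume_real_Icc_of_le (by linarith), Real.volume_real_Icc_of_le (by linarith)]
    ring
  have hA'fin : volume A' < ⊤ := by
    rw [hA'def, Measure.volume_eq_prod, Measure.prod_prod]; exact ENNReal.mul_lt_top measure_Icc_lt_top measure_Icc_lt_top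
  have hV : 0 < ρO ^ 2 / 8 := by positivity
  have hVA : ρO ^ 2 / 8 ≤ volume.real A' := by
    rw [hA'vol]
    have h1 : ρO / 4 ≤ ρO / 2 - ρ₀ := by linarith
    calc ρO ^ 2 / 8 = (ρO / 4) * (ρO / 2) := by ring
      _ ≤ (ρO / 2 - ρ₀) * (ρO / 2) := mul_le_mul_of_nonneg_right h1 (by positivity)
  -- the pointwise law on the disc (H): `κ = ½`, `R = 2δr·R₀`
  have hwinδr : ∀ p p' : ℝ × ℝ, dist p p' ≤ ρO →
      (122689728 * δr⁻¹ + 44712000 * ‖(gnoBase p.1 p.2 : GnoCoord L) - gnoBase p'.1 p'.2‖) * (L : ℝ) ^ 4 ≤ μ / (2 * (3 * n)) := by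
    intro p p' hd
    have h1 := hwin1
    have h2 := hwin2 _ ((norm_gnoBase_sub_le (L := L) p p').trans hd)
    rw [add_mul]
    linarith
  have H : ∀ δt ∈ Mid, ∀ δs ∈ Icc δr (2 * δr), ∀ p : ℝ × ℝ, p.1 ^ 2 + p.2 ^ 2 < ρ₀ ^ 2 →
      mbDensity (L := L) (hubAt δt 1) ε p * δs * (1 + (1 / 2 : ℝ) * (p.1 ^ 2 + p.2 ^ 2) * (1 + δt ^ 2)) ≤
        (2 * δr * R₀) * (1 + δt ^ 2) ^ 2 * mbDensity (L := L) (hubAt δs 1) ε p := by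
    intro δt hδt δs hδs p hp
    have hlt : δ₁ < δt := hMid₁ hδt
    have hδt : δr ≤ δt := by linarith [hδs.1, hδ₁c]
    have hw := hwinδr p p (by simp [hρO0.le])
    have h := mbDensity_hubAt_comparable_profile (L := L) hε hδr1 hδs.1 hδt p p hw
    have hm0 : 0 ≤ mbDensity (L := L) (hubAt δt 1) ε p := mbDensity_nonneg _ ε p
    have hms0 : 0 ≤ mbDensity (L := L) (hubAt δs 1) ε p := mbDensity_nonneg _ ε p
    have hT0 : 0 < 1 + δt ^ 2 := by positivity
    -- `h(p) ≥ |p|²/2` on the unit disc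
    have hρsq : ρ₀ ^ 2 ≤ 1 := pow_le_one₀ hρ₀.le hρ₀1
    have hx : p.1 ^ 2 ≤ 1 := by linarith [sq_nonneg p.2]
    have hy : p.2 ^ 2 ≤ 1 := by linarith [sq_nonneg p.1]
    have hh : (1 / 2 : ℝ) * (p.1 ^ 2 + p.2 ^ 2) ≤ p.1 ^ 2 / (1 + p.1 ^ 2) + p.2 ^ 2 / (1 + p.2 ^ 2) := by
      have e1 : p.1 ^ 2 / 2 ≤ p.1 ^ 2 / (1 + p.1 ^ 2) := div_le_div_of_nonneg_left (sq_nonneg _) (by positivity) (by linarith)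
      have e2 : p.2 ^ 2 / 2 ≤ p.2 ^ 2 / (1 + p.2 ^ 2) := div_le_div_of_nonneg_left (sq_nonneg _) (by positivity) (by linarith)
      linarith
    have hden : 1 + (1 / 2 : ℝ) * (p.1 ^ 2 + p.2 ^ 2) * (1 + δt ^ 2) ≤ 1 + (p.1 ^ 2 / (1 + p.1 ^ 2) + p.2 ^ 2 / (1 + p.2 ^ 2)) * (1 + δt ^ 2) := by
      have h3 := mul_le_mul_of_nonneg_right hh hT0.le
      linarith
    have hden0 : 0 < 1 + (p.1 ^ 2 / (1 + p.1 ^ 2) + p.2 ^ 2 / (1 + p.2 ^ 2)) * (1 + δt ^ 2) := by positivity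
    have hw1 : (1 + p.1 ^ 2) * (1 + p.2 ^ 2) / ((1 + p.1 ^ 2) * (1 + p.2 ^ 2)) = 1 := div_self (by positivity)
    rw [hw1, mul_one] at h
    -- from `𝔪_t ≤ R₀·T²/(1+hT)·𝔪_s`
    have h2 : mbDensity (L := L) (hubAt δt 1) ε p * (1 + (1 / 2 : ℝ) * (p.1 ^ 2 + p.2 ^ 2) * (1 + δt ^ 2)) ≤ R₀ * (1 + δt ^ 2) ^ 2 * mbDensity (L := L) (hubAt δs 1) ε p := by
      calc mbDensity (L := L) (hubAt δt 1) ε p * (1 + (1 / 2 : ℝ) * (p.1 ^ 2 + p.2 ^ 2) * (1 + δt ^ 2))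
          ≤ mbDensity (L := L) (hubAt δt 1) ε p * (1 + (p.1 ^ 2 / (1 + p.1 ^ 2) + p.2 ^ 2 / (1 + p.2 ^ 2)) * (1 + δt ^ 2)) := mul_le_mul_of_nonneg_left hden hm0
        _ ≤ (R₀ * ((1 + δt ^ 2) ^ 2 / (1 + (p.1 ^ 2 / (1 + p.1 ^ 2) + p.2 ^ 2 / (1 + p.2 ^ 2)) * (1 + δt ^ 2))) * mbDensity (L := L) (hubAt δs 1) ε p) *
              (1 + (p.1 ^ 2 / (1 + p.1 ^ 2) + p.2 ^ 2 / (1 + p.2 ^ 2)) * (1 + δt ^ 2)) := mul_le_mul_of_nonneg_right h hden0.le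
        _ = R₀ * (1 + δt ^ 2) ^ 2 * mbDensity (L := L) (hubAt δs 1) ε p := by field_simp
    have hδs2 : δs ≤ 2 * δr := hδs.2
    have hδs0 : 0 ≤ δs := by linarith [hδs.1]
    calc mbDensity (L := L) (hubAt δt 1) ε p * δs * (1 + (1 / 2 : ℝ) * (p.1 ^ 2 + p.2 ^ 2) * (1 + δt ^ 2))
        = (mbDensity (L := L) (hubAt δt 1) ε p * (1 + (1 / 2 : ℝ) * (p.1 ^ 2 + p.2 ^ 2) * (1 + δt ^ 2))) * δs := by ring
      _ ≤ (R₀ * (1 + δt ^ 2) ^ 2 * mbDensity (L := L) (hubAt δs 1) ε p) * (2 * δr) := mul_le_mul h2 hδs2 hδs0 (mul_nonneg (mul_nonneg hR₀0.le (by positivity)) hms0)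
      _ = (2 * δr * R₀) * (1 + δt ^ 2) ^ 2 * mbDensity (L := L) (hubAt δs 1) ε p := by ring
  -- the oscillation on the shell (hOsc): `Osc = R₀(1+(2δr)²)²(1+ρO²)²`
  have hOsc : ∀ δs ∈ Icc δr (2 * δr), ∀ p : ℝ × ℝ, p.1 ^ 2 + p.2 ^ 2 < ρ₀ ^ 2 → ∀ p' ∈ A',
      mbDensity (L := L) (hubAt δs 1) ε p ≤ (R₀ * (1 + (2 * δr) ^ 2) ^ 2 * (1 + ρO ^ 2) ^ 2) * mbDensity (L := L) (hubAt δs 1) ε p' := by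
    intro δs hδs p hp p' hp'
    rw [hA'def] at hp'
    obtain ⟨⟨hp1a, hp1b⟩, ⟨hp2a, hp2b⟩⟩ := hp'
    -- the distance `dist p p' ≤ ρO`
    have hx : |p.1| ≤ ρ₀ := by
      have h := sq_le_sq.1 (show p.1 ^ 2 ≤ ρ₀ ^ 2 by linarith [sq_nonneg p.2]); rwa [abs_of_nonneg hρ₀.le] at h
    have hy : |p.2| ≤ ρ₀ := by
      have h := sq_le_sq.1 (show p.2 ^ 2 ≤ ρ₀ ^ 2 by linarith [sq_nonneg p.1]); rwa [abs_of_nonneg hρ₀.le] at h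
    have hd : dist p p' ≤ ρO := by
      rw [Prod.dist_eq, Real.dist_eq, Real.dist_eq]
      refine max_le ?_ ?_
      · have := abs_le.1 hx; rw [abs_le]; constructor <;> linarith
      · have := abs_le.1 hy; rw [abs_le]; constructor <;> linarith
    have hw := hwinδr p p' hd
    have h := mbDensity_hubAt_comparable_profile (L := L) hε hδr1 hδs.1 hδs.1 p p' hw
    have hms0 : 0 ≤ mbDensity (L := L) (hubAt δs 1) ε p' := mbDensity_nonneg _ ε p'
    have hT0 : 0 < 1 + δs ^ 2 := by positivity
    have hfrac : (1 + δs ^ 2) ^ 2 / (1 + (p.1 ^ 2 / (1 + p.1 ^ 2) + p.2 ^ 2 / (1 + p.2 ^ 2)) * (1 + δs ^ 2)) ≤ (1 + (2 * δr) ^ 2) ^ 2 := by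
      have hh0 : 0 ≤ p.1 ^ 2 / (1 + p.1 ^ 2) + p.2 ^ 2 / (1 + p.2 ^ 2) := by positivity
      have h1 : (1 + δs ^ 2) ^ 2 / (1 + (p.1 ^ 2 / (1 + p.1 ^ 2) + p.2 ^ 2 / (1 + p.2 ^ 2)) * (1 + δs ^ 2)) ≤ (1 + δs ^ 2) ^ 2 :=
        div_le_self (by positivity) (le_add_of_nonneg_right (mul_nonneg hh0 hT0.le))
      have h2 : (1 + δs ^ 2) ^ 2 ≤ (1 + (2 * δr) ^ 2) ^ 2 := by
        have : δs ^ 2 ≤ (2 * δr) ^ 2 := pow_le_pow_left₀ (by linarith [hδs.1]) hδs.2 2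
        exact pow_le_pow_left₀ (by positivity) (by linarith) 2
      exact h1.trans h2
    have hwt : (1 + p'.1 ^ 2) * (1 + p'.2 ^ 2) / ((1 + p.1 ^ 2) * (1 + p.2 ^ 2)) ≤ (1 + ρO ^ 2) ^ 2 := by
      have h1 : (1 + p'.1 ^ 2) * (1 + p'.2 ^ 2) / ((1 + p.1 ^ 2) * (1 + p.2 ^ 2)) ≤ (1 + p'.1 ^ 2) * (1 + p'.2 ^ 2) :=
        div_le_self (by positivity) (one_le_mul_of_one_le_of_one_le (le_add_of_nonneg_right (sq_nonneg p.1)) (le_add_of_nonneg_right (sq_nonneg p.2)))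
      have h2 : p'.1 ^ 2 ≤ ρO ^ 2 := pow_le_pow_left₀ (hρ₀.le.trans hp1a) (hp1b.trans (by linarith)) 2
      have h3 : p'.2 ^ 2 ≤ ρO ^ 2 := pow_le_pow_left₀ hp2a (hp2b.trans (by linarith)) 2
      have h4 : (1 + p'.1 ^ 2) * (1 + p'.2 ^ 2) ≤ (1 + ρO ^ 2) ^ 2 := by
        calc (1 + p'.1 ^ 2) * (1 + p'.2 ^ 2) ≤ (1 + ρO ^ 2) * (1 + ρO ^ 2) := mul_le_mul (by linarith) (by linarith) (by positivity) (by positivity)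
          _ = (1 + ρO ^ 2) ^ 2 := by ring
      exact h1.trans h4
    calc mbDensity (L := L) (hubAt δs 1) ε p
        ≤ R₀ * ((1 + δs ^ 2) ^ 2 / (1 + (p.1 ^ 2 / (1 + p.1 ^ 2) + p.2 ^ 2 / (1 + p.2 ^ 2)) * (1 + δs ^ 2))) *
            ((1 + p'.1 ^ 2) * (1 + p'.2 ^ 2) / ((1 + p.1 ^ 2) * (1 + p.2 ^ 2))) * mbDensity (L := L) (hubAt δs 1) ε p' := h
      _ = R₀ * (((1 + δs ^ 2) ^ 2 / (1 + (p.1 ^ 2 / (1 + p.1 ^ 2) + p.2 ^ 2 / (1 + p.2 ^ 2)) * (1 + δs ^ 2))) *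
            ((1 + p'.1 ^ 2) * (1 + p'.2 ^ 2) / ((1 + p.1 ^ 2) * (1 + p.2 ^ 2)))) * mbDensity (L := L) (hubAt δs 1) ε p' := by ring
      _ ≤ R₀ * ((1 + (2 * δr) ^ 2) ^ 2 * (1 + ρO ^ 2) ^ 2) * mbDensity (L := L) (hubAt δs 1) ε p' :=
          mul_le_mul_of_nonneg_right (mul_le_mul_of_nonneg_left (mul_le_mul hfrac hwt (by positivity) (by positivity)) hR₀0.le) hms0
      _ = R₀ * (1 + (2 * δr) ^ 2) ^ 2 * (1 + ρO ^ 2) ^ 2 * mbDensity (L := L) (hubAt δs 1) ε p' := by ring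
  -- integrability along the shell
  have hInt : ∀ δs ∈ Icc δr (2 * δr), IntegrableOn (fun p : ℝ × ℝ => mbDensity (L := L) (hubAt δs 1) ε p) Box :=
    fun δs hδs => (integrable_mbDensity_hubAt_of_window hε hτ hτ1 (hshell hδs)).integrableOn
  have hS : IntegrableOn (fun δ : ℝ => ((1 + δ ^ 2)⁻¹) ^ 2 * ∫ p in Box, mbDensity (L := L) (hubAt δ 1) ε p) (Icc δr (2 * δr)) :=
    (integrableOn_sqInv_mul_boxMass hε hτ hτ1 Box).mono_set hshell
  -- the layer
  have hlayer := tipCorner_le_shell_of_pointwise (L := L) ε hMid hδ₁0 hMid₁ hδr0 (by linarith : δr < 2 * δr) hA'm hA'B hA'fin hV hVA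
    (κ := 1 / 2) (R := 2 * δr * R₀) (Osc := R₀ * (1 + (2 * δr) ^ 2) ^ 2 * (1 + ρO ^ 2) ^ 2) (by norm_num)
    (mul_nonneg (mul_nonneg (by norm_num) hδr0.le) hR₀0.le) (mul_nonneg (mul_nonneg hR₀0.le (by positivity)) (by positivity)) hρ₀.le
    H hOsc hInt hS
  -- the shell box mass against the bulk main term
  have hshellMain := shell_boxMass_le_mbMain (L := L) hε hτ hτ1 hδr1 hc2 Box
  have hpre0 : 0 ≤ (256 * (2 * δr * R₀) * (R₀ * (1 + (2 * δr) ^ 2) ^ 2 * (1 + ρO ^ 2) ^ 2) * (1 + 2 * Real.sqrt (1 / 2) * ρ₀) ^ (1 / 4 : ℝ) /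
      ((1 / 2 : ℝ) * (ρO ^ 2 / 8))) / (((1 + δr ^ 2)⁻¹ - (1 + (2 * δr) ^ 2)⁻¹) / 2) * ((4 / 3) * δ₁ ^ (-(3 / 4 : ℝ))) := by
    have hW0 : 0 < ((1 + δr ^ 2)⁻¹ - (1 + (2 * δr) ^ 2)⁻¹) / 2 := by
      have h : (1 + (2 * δr) ^ 2)⁻¹ < (1 + δr ^ 2)⁻¹ := by
        apply inv_strictAnti₀ (by positivity)
        have e : (2 * δr) ^ 2 = 4 * δr ^ 2 := by ring
        rw [e]; linarith [sq_pos_of_pos hδr0]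
      linarith
    have hX : 0 ≤ (1 + 2 * Real.sqrt (1 / 2) * ρ₀) ^ (1 / 4 : ℝ) := Real.rpow_nonneg (by positivity) _
    have hq : 0 ≤ δ₁ ^ (-(3 / 4 : ℝ)) := Real.rpow_nonneg hδ₁0.le _
    positivity
  have hBox0 : 0 ≤ ∫ δ in Icc δr (2 * δr), ((1 + δ ^ 2)⁻¹) ^ 2 * ∫ p in Box, mbDensity (L := L) (hubAt δ 1) ε p :=
    setIntegral_nonneg measurableSet_Icc fun δ _ => mul_nonneg (by positivity) (integral_nonneg fun p => mbDensity_nonneg _ ε p)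
  calc coneConst * Real.pi * ∫ δ in Mid, ((1 + δ ^ 2)⁻¹) ^ 2 * ∫ p in D, mbDensity (L := L) (hubAt δ 1) ε p
      ≤ coneConst * Real.pi * ((256 * (2 * δr * R₀) * (R₀ * (1 + (2 * δr) ^ 2) ^ 2 * (1 + ρO ^ 2) ^ 2) * (1 + 2 * Real.sqrt (1 / 2) * ρ₀) ^ (1 / 4 : ℝ) /
          ((1 / 2 : ℝ) * (ρO ^ 2 / 8))) / (((1 + δr ^ 2)⁻¹ - (1 + (2 * δr) ^ 2)⁻¹) / 2) * ((4 / 3) * δ₁ ^ (-(3 / 4 : ℝ))) *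
          ∫ δ in Icc δr (2 * δr), ((1 + δ ^ 2)⁻¹) ^ 2 * ∫ p in Box, mbDensity (L := L) (hubAt δ 1) ε p) := mul_le_mul_of_nonneg_left hlayer hcc.le
    _ = (256 * (2 * δr * R₀) * (R₀ * (1 + (2 * δr) ^ 2) ^ 2 * (1 + ρO ^ 2) ^ 2) * (1 + 2 * Real.sqrt (1 / 2) * ρ₀) ^ (1 / 4 : ℝ) /
          ((1 / 2 : ℝ) * (ρO ^ 2 / 8))) / (((1 + δr ^ 2)⁻¹ - (1 + (2 * δr) ^ 2)⁻¹) / 2) * ((4 / 3) * δ₁ ^ (-(3 / 4 : ℝ))) *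
          (coneConst * Real.pi * ∫ δ in Icc δr (2 * δr), ((1 + δ ^ 2)⁻¹) ^ 2 * ∫ p in Box, mbDensity (L := L) (hubAt δ 1) ε p) := by ring
    _ ≤ (256 * (2 * δr * R₀) * (R₀ * (1 + (2 * δr) ^ 2) ^ 2 * (1 + ρO ^ 2) ^ 2) * (1 + 2 * Real.sqrt (1 / 2) * ρ₀) ^ (1 / 4 : ℝ) /
          ((1 / 2 : ℝ) * (ρO ^ 2 / 8))) / (((1 + δr ^ 2)⁻¹ - (1 + (2 * δr) ^ 2)⁻¹) / 2) * ((4 / 3) * δ₁ ^ (-(3 / 4 : ℝ))) *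
          ∫ a in HubBulk τ, (∫ p : ℝ × ℝ, mbDensity (L := L) a ε p) ∂coneMeasure := mul_le_mul_of_nonneg_left hshellMain hpre0

end Summit.QuantumFields.YangMills.Theorems.SwapVirialDeficit.SectorLaplace

end
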